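import Summits.ValiantsHypothesis.ValiantsHypothesis.Theorems.NcSkewStructure
import HarnessLib

/-!
# The unbalance dial, structure half: framed bodies with body degrees in a window

Workshop file for the node `CommutativityDial` (decomp-valiant lens 6 «restricted-models lifting axis»;
offer O-L6-13 «THE UNBALANCE DIAL», FILE 1 of 3). Limaye–Malod–Srinivasan (ToC 12 (2016), Def. 5.6 /
Cor. 5.7) extend their skew-circuit lower bound to `δ`-UNBALANCED circuits: every product gate has an
argument of degree `≤ δ`. This file proves the STRUCTURE half of that rung on the RAW fan-in-two
circuit, for every commutative semiring, under the weakest hypothesis the argument uses — stated PER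
PRODUCT GATE and SEMANTICALLY (no homogenisation, no syntactic degree): for the product gate `o · o'`
read after the gates `l₁`, every pair of components of degrees `b, b' ≥ w + 2` with `b + b' ≤ d`
multiplies to zero («`(w+2)`-unbalanced up to degree `d`»; `w + 1 = δ`). The DIAL is the window
width `w`: `w = 0` contains the skew programs (`skew_unbalanced`), the hypothesis is monotone in `w`
(`unbalanced_mono`), and once `2 (w + 2) > d` EVERY fan-in-two program satisfies it
(`unbalanced_of_lt`) — the dial runs from the skew rung to all circuits; the rank half
(`NcUnbalancedRank`) prices each notch by the factor `Σ_{j ≤ w} n^j`.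

* §1 `unbSpan B d e w a`: the `R`-span of framed bodies `h · g · h̄` with body `g ∈ B c` of a degree
  `c` in the WINDOW `[e, e + w]` and homogeneous frames (`w = 0`: `NcSkewStructure.skewSpan`);
  closure under homogeneous left/right multiplication.
* §2 `gate_mem_unbSpan` / `gates_mem_unbSpan` / `unbalanced_structure`: for `2 ≤ e`, every component
  of degree `e ≤ a ≤ d` of every gate value lies in the unbalanced span over the circuit's OWN bodies
  (components of gate values of degrees in `[e, e + w]`). Product gate `u · u'`, `(u u')_a =
  Σ_c u_c u'_{a−c}`: `c ≤ w + 1` ⇒ left frame `u_c` times the component `u'_{a−c}`, `a − c ≥ e` once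
  `a > e + w`; `a − c ≤ w + 1` symmetric; both `≥ w + 2` ⇒ the term vanishes by hypothesis; and for
  `a ≤ e + w` the component is itself a body.
* §3 the ends of the dial: monotonicity in `w`; the vacuous end `2 (w + 2) > d`; Def. 5.6 read
  semantically («one operand's VALUE has degree `≤ w + 1`», all its components of degrees
  `w + 2 ≤ b ≤ d + 1` vanish, `b = d + 1` naming the tail) implies the hypothesis
  (`unbalanced_of_degree`); a SKEW program has that property for every `w` (`skew_degree`) and is
  `2`-unbalanced (`skew_unbalanced`, the `w = 0` end); `skew_structure_window` recovers FILE
  `NcSkewStructure`'s theorem.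

HONEST FRAMING: bookkeeping generalisation of `NcSkewStructure` (LMS16 Lemma 5.2 ↦ the class of
Cor. 5.7, print p. 11–12: their proof converts a `δ`-unbalanced circuit to a skew one with an
`O(n^δ)` loss; here the graded span is pushed through the program directly); the rank half
(exponential lower bounds for `LID_r` / `PERM_n` against `(w+2)`-unbalanced circuits, degrading as
`Σ_{j ≤ w} n^j`) is FILE 2 `NcUnbalancedRank`, the permanent FILE 3 `NcUnbalancedPermanent`. Nothing
here bears on general noncommutative circuits (`A_nc`, item 23446) or on `VP ≠ VNP`.
-/

noncomputable section

namespace Summit.ValiantsHypothesis.ValiantsHypothesis.Theorems.NcUnbalancedStructure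

open Literature.Computability.AlgebraicComplexity
open Literature.Computability.AlgebraicComplexity.ArithCircuit
open Summit.ValiantsHypothesis.ValiantsHypothesis.Theorems.NcAutomatonIntersection
open Summit.ValiantsHypothesis.ValiantsHypothesis.Theorems.NcCentralWidth
open Summit.ValiantsHypothesis.ValiantsHypothesis.Theorems.NcSkewStructure

universe u v

variable {R : Type u} [CommSemiring R] {σ : Type v}

/-! ## §1 Unbalanced spans -/

/-- The UNBALANCED SPAN of total degree `a`: the `R`-span of the framed bodies `h · g · h̄` with body
`g ∈ B c` of a degree `c` in the window `e ≤ c ≤ e + w` and frames `h = h_r`, `h̄ = h̄_{a−c−r}`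
homogeneous. [cite: LimayeMalodSrinivasan2016, Lemma 5.2, Def. 5.6] -/
def unbSpan (B : ℕ → Set (FreeAlgebra R σ)) (d e w a : ℕ) : Submodule R (FreeAlgebra R σ) :=
  Submodule.span R {x | ∃ (c r : ℕ) (g h hb : FreeAlgebra R σ), e ≤ c ∧ c ≤ e + w ∧ g ∈ B c ∧
    c + r ≤ a ∧ degPart d r h = h ∧ degPart d (a - c - r) hb = hb ∧ x = h * g * hb}

/-- Unbalanced spans grow with the body sets. [cite: LimayeMalodSrinivasan2016, Lemma 5.2] -/
theorem unbSpan_mono {B B' : ℕ → Set (FreeAlgebra R σ)} (hBB : ∀ c, B c ⊆ B' c) (d e w a : ℕ) :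
    unbSpan B d e w a ≤ unbSpan B' d e w a :=
  Submodule.span_mono fun _ ⟨c, r, g, h, hb, hec, hcw, hg, hcr, hh, hhb, hx⟩ =>
    ⟨c, r, g, h, hb, hec, hcw, hBB c hg, hcr, hh, hhb, hx⟩

/-- A body of a window degree is in the unbalanced span of its own degree (`h = h̄ = 1`).
[cite: LimayeMalodSrinivasan2016, Lemma 5.2] -/
theorem body_mem_unbSpan {B : ℕ → Set (FreeAlgebra R σ)} {d e w c : ℕ} {g : FreeAlgebra R σ}
    (hec : e ≤ c) (hcw : c ≤ e + w) (hg : g ∈ B c) : g ∈ unbSpan B d e w c :=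
  Submodule.subset_span ⟨c, 0, g, 1, 1, hec, hcw, hg, le_rfl, degPart_zero_one d,
    by rw [show c - c - 0 = 0 by omega]; exact degPart_zero_one d, by rw [one_mul, mul_one]⟩

/-- Right multiplication by `q = q_c'`: total degree `a ↦ a + c' ≤ d`. [cite: LimayeMalodSrinivasan2016, Lemma 5.2] -/
theorem unbSpan_mul_right {B : ℕ → Set (FreeAlgebra R σ)} {d e w a c' : ℕ} {x q : FreeAlgebra R σ}
    (hx : x ∈ unbSpan B d e w a) (hq : degPart d c' q = q) (hac : a + c' ≤ d) :
    x * q ∈ unbSpan B d e w (a + c') := by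
  have key : unbSpan B d e w a ≤ (unbSpan B d e w (a + c')).comap (LinearMap.mulRight R q) := by
    refine Submodule.span_le.mpr ?_
    rintro _ ⟨c, r, g, h, hb, hec, hcw, hg, hcr, hh, hhb, rfl⟩
    rw [SetLike.mem_coe, Submodule.mem_comap, LinearMap.mulRight_apply]
    refine Submodule.subset_span ⟨c, r, g, h, hb * q, hec, hcw, hg, by omega, hh, ?_, mul_assoc _ _ _⟩
    have := degPart_mul_of_eq hhb hq (by omega)
    rwa [show a - c - r + c' = a + c' - c - r by omega] at this
  simpa only [Submodule.mem_comap, LinearMap.mulRight_apply] using key hx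

/-- Left multiplication by `q = q_c'`: total degree `a ↦ c' + a ≤ d`. [cite: LimayeMalodSrinivasan2016, Lemma 5.2] -/
theorem unbSpan_mul_left {B : ℕ → Set (FreeAlgebra R σ)} {d e w a c' : ℕ} {x q : FreeAlgebra R σ}
    (hx : x ∈ unbSpan B d e w a) (hq : degPart d c' q = q) (hca : c' + a ≤ d) :
    q * x ∈ unbSpan B d e w (c' + a) := by
  have key : unbSpan B d e w a ≤ (unbSpan B d e w (c' + a)).comap (LinearMap.mulLeft R q) := by
    refine Submodule.span_le.mpr ?_
    rintro _ ⟨c, r, g, h, hb, hec, hcw, hg, hcr, hh, hhb, rfl⟩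
    rw [SetLike.mem_coe, Submodule.mem_comap, LinearMap.mulLeft_apply]
    refine Submodule.subset_span ⟨c, c' + r, g, q * h, hb, hec, hcw, hg, by omega,
      degPart_mul_of_eq hq hh (by omega), ?_, by rw [← mul_assoc, ← mul_assoc]⟩
    rwa [show c' + a - c - (c' + r) = a - c - r by omega]
  simpa only [Submodule.mem_comap, LinearMap.mulLeft_apply] using key hx

/-! ## §2 The unbalanced structure theorem -/

/-- Operands: letters/scalars vanish in degree `≥ e ≥ 2`; gate references inherit. [cite: LimayeMalodSrinivasan2016, Lemma 5.2] -/
theorem operand_mem_unbSpan {B : ℕ → Set (FreeAlgebra R σ)} {d e w : ℕ} (he : 2 ≤ e)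
    (vals : List (FreeAlgebra R σ))
    (hvals : ∀ p ∈ vals, ∀ a, e ≤ a → a ≤ d → degPart d a p ∈ unbSpan B d e w a)
    (o : Operand R σ) {a : ℕ} (hea : e ≤ a) (had : a ≤ d) :
    degPart d a (o.ncEval vals) ∈ unbSpan B d e w a := by
  cases o with
  | var x =>
    rw [show (Operand.var x : Operand R σ).ncEval vals = FreeAlgebra.ι R x from rfl,
      degPart_ι_eq_zero (by omega) had]
    exact zero_mem _
  | const c =>
    rw [show (Operand.const c : Operand R σ).ncEval vals = algebraMap R _ c from rfl,
      degPart_algebraMap_eq_zero (by omega) had]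
    exact zero_mem _
  | gate i =>
    rw [ncEval_gate, List.getD_eq_getElem?_getD]
    by_cases hi : i < vals.length
    · rw [List.getElem?_eq_getElem hi, Option.getD_some]
      exact hvals _ (List.getElem_mem hi) a hea had
    · rw [List.getElem?_eq_none_iff.mpr (Nat.le_of_not_lt hi), Option.getD_none, map_zero]
      exact zero_mem _

/-- **One `(w+2)`-unbalanced gate** (fan-in `≤ 2`): for `a ≤ e + w` the component is a body; above the
window, in `(u u')_a = Σ_c u_c u'_{a−c}` a term with `c ≤ w + 1` is a left frame times a component of
degree `a − c ≥ e`, a term with `a − c ≤ w + 1` symmetric, and a term with both `≥ w + 2` VANISHES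
(the hypothesis). [cite: LimayeMalodSrinivasan2016, Def. 5.6, Lemma 5.2] -/
theorem gate_mem_unbSpan {B : ℕ → Set (FreeAlgebra R σ)} {d e w : ℕ} (he : 2 ≤ e)
    (vals : List (FreeAlgebra R σ))
    (hvals : ∀ p ∈ vals, ∀ a, e ≤ a → a ≤ d → degPart d a p ∈ unbSpan B d e w a)
    (g : Gate R σ) (hg : g.fanIn ≤ 2)
    (hunb : ∀ o o' : Operand R σ, g = Gate.prod [o, o'] → ∀ b b' : ℕ, w + 2 ≤ b → w + 2 ≤ b' →
      b + b' ≤ d → degPart d b (o.ncEval vals) * degPart d b' (o'.ncEval vals) = 0)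
    (hbody : ∀ c, e ≤ c → c ≤ e + w → c ≤ d → degPart d c (g.ncEval vals) ∈ B c)
    {a : ℕ} (hea : e ≤ a) (had : a ≤ d) :
    degPart d a (g.ncEval vals) ∈ unbSpan B d e w a := by
  by_cases haw : a ≤ e + w
  · exact body_mem_unbSpan hea haw (hbody a hea haw had)
  clear hbody
  cases g with
  | sum args =>
    rw [show Gate.ncEval vals (Gate.sum args) = (args.map fun ca => ca.1 • ca.2.ncEval vals).sum
      from rfl, map_list_sum, List.map_map]
    refine list_sum_mem fun x hx => ?_
    obtain ⟨⟨c, o⟩, -, rfl⟩ := List.mem_map.mp hx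
    show degPart d a (c • o.ncEval vals) ∈ _
    rw [map_smul]
    exact Submodule.smul_mem _ c (operand_mem_unbSpan he vals hvals o hea had)
  | prod args =>
    match args, hg, hunb with
    | [], _, _ =>
      rw [show Gate.ncEval vals (Gate.prod []) = (1 : FreeAlgebra R σ) by simp [Gate.ncEval],
        ← map_one (algebraMap R (FreeAlgebra R σ)), degPart_algebraMap_eq_zero (by omega) had]
      exact zero_mem _
    | [o], _, _ =>
      rw [show Gate.ncEval vals (Gate.prod [o]) = o.ncEval vals by simp [Gate.ncEval]]
      exact operand_mem_unbSpan he vals hvals o hea had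
    | [o, o'], _, hunb =>
      rw [show Gate.ncEval vals (Gate.prod [o, o']) = o.ncEval vals * o'.ncEval vals by
        simp [Gate.ncEval], degPart_mul d had]
      refine Submodule.sum_mem _ fun c _ => ?_
      split_ifs with hc
      · by_cases hcw : c.1 ≤ w + 1
        · -- small LEFT degree: left frame `u_c` times the component `u'_{a−c}`, `a − c ≥ e`
          have := unbSpan_mul_left
            (operand_mem_unbSpan he vals hvals o' (a := a - c.1) (by omega) (by omega))
            (degPart_idem d c.1 (o.ncEval vals)) (by omega)
          rwa [show c.1 + (a - c.1) = a by omega] at this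
        · by_cases hcw' : a - c.1 ≤ w + 1
          · -- small RIGHT degree: the component `u_c`, `c ≥ e`, times the right frame `u'_{a−c}`
            have := unbSpan_mul_right
              (operand_mem_unbSpan he vals hvals o (a := c.1) (by omega) (le_trans hc had))
              (degPart_idem d (a - c.1) (o'.ncEval vals)) (by omega)
            rwa [show c.1 + (a - c.1) = a by omega] at this
          · -- both degrees `≥ w + 2`: the term vanishes
            rw [hunb o o' rfl c.1 (a - c.1) (by omega) (by omega) (by omega)]
            exact zero_mem _
      · rw [mul_zero]
        exact zero_mem _
    | _ :: _ :: _ :: _, hg, _ => simp [Gate.fanIn, Gate.args] at hg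

/-- **All gates** (reverse induction on the program) under the PER-GATE hypothesis: for every
decomposition `gs = l₁ ++ (o · o') :: l₂`, the components of `o, o'` (read after `l₁`) of degrees
`b, b' ≥ w + 2`, `b + b' ≤ d`, multiply to zero. [cite: LimayeMalodSrinivasan2016, Def. 5.6, Lemma 5.2] -/
theorem gates_mem_unbSpan {d e w : ℕ} (he : 2 ≤ e) (gs : List (Gate R σ))
    (h2 : ∀ g ∈ gs, g.fanIn ≤ 2)
    (hunb : ∀ (l₁ : List (Gate R σ)) (o o' : Operand R σ) (l₂ : List (Gate R σ)),
      gs = l₁ ++ Gate.prod [o, o'] :: l₂ → ∀ b b' : ℕ, w + 2 ≤ b → w + 2 ≤ b' → b + b' ≤ d →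
        degPart d b (o.ncEval (ncGateValues l₁)) * degPart d b' (o'.ncEval (ncGateValues l₁)) = 0) :
    ∀ p ∈ ncGateValues gs, ∀ a, e ≤ a → a ≤ d →
      degPart d a p ∈ unbSpan (bodies (ncGateValues gs) d) d e w a := by
  induction gs using List.reverseRecOn with
  | nil => intro p hp; simp [ncGateValues] at hp
  | append_singleton gs g ih =>
    have h2' : ∀ g' ∈ gs, g'.fanIn ≤ 2 := fun g' hg' => h2 g' (List.mem_append_left _ hg')
    have hunb' : ∀ (l₁ : List (Gate R σ)) (o o' : Operand R σ) (l₂ : List (Gate R σ)),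
        gs = l₁ ++ Gate.prod [o, o'] :: l₂ → ∀ b b' : ℕ, w + 2 ≤ b → w + 2 ≤ b' → b + b' ≤ d →
          degPart d b (o.ncEval (ncGateValues l₁)) * degPart d b' (o'.ncEval (ncGateValues l₁)) = 0 :=
      fun l₁ o o' l₂ h => hunb l₁ o o' (l₂ ++ [g]) (by rw [h, List.append_assoc, List.cons_append])
    have hg : g.fanIn ≤ 2 := h2 g (List.mem_append_right _ (List.mem_singleton_self g))
    have hsub : ncGateValues gs ⊆ ncGateValues (gs ++ [g]) := by
      rw [ncGateValues_append_singleton]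
      exact List.subset_append_left _ _
    have hmono : ∀ a, unbSpan (bodies (ncGateValues gs) d) d e w a ≤
        unbSpan (bodies (ncGateValues (gs ++ [g])) d) d e w a :=
      fun a => unbSpan_mono (fun c => bodies_mono hsub d c) d e w a
    intro p hp a hea had
    have hp' := hp
    rw [ncGateValues_append_singleton, List.mem_append, List.mem_singleton] at hp'
    rcases hp' with hp' | rfl
    · exact hmono a (ih h2' hunb' p hp' a hea had)
    · exact gate_mem_unbSpan he (ncGateValues gs)
        (fun p hp a hea had => hmono a (ih h2' hunb' p hp a hea had)) g hg
        (fun o o' hgo b b' hb hb' hbb => hunb gs o o' [] (by rw [hgo]) b b' hb hb' hbb)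
        (fun c _ _ _ => ⟨g.ncEval (ncGateValues gs), hp, rfl⟩) hea had

/-- **UNBALANCED STRUCTURE THEOREM, SPAN FORM** (the structure half of Limaye–Malod–Srinivasan's
Cor. 5.7 on the raw circuit, every commutative semiring): for `2 ≤ e ≤ d` and window width `w`, a
fan-in-two circuit value homogeneous of degree `d` whose product gates are `(w+2)`-unbalanced up to
degree `d` (semantically, per gate) is an `R`-combination of framed bodies `h · g · h̄` — bodies `g` the
components of degrees in `[e, e + w]` of its own gate values, frames homogeneous.
[cite: LimayeMalodSrinivasan2016, Cor. 5.7, Lemma 5.2] -/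
theorem unbalanced_structure (P : ArithCircuit R σ) (hP : P.IsFanInTwo) {d e w : ℕ}
    (hunb : ∀ (l₁ : List (Gate R σ)) (o o' : Operand R σ) (l₂ : List (Gate R σ)),
      P.gates = l₁ ++ Gate.prod [o, o'] :: l₂ → ∀ b b' : ℕ, w + 2 ≤ b → w + 2 ≤ b' → b + b' ≤ d →
        degPart d b (o.ncEval (ncGateValues l₁)) * degPart d b' (o'.ncEval (ncGateValues l₁)) = 0)
    (he : 2 ≤ e) (hed : e ≤ d) (hf : degPart d d P.ncEval = P.ncEval) :
    P.ncEval ∈ unbSpan (bodies (ncGateValues P.gates) d) d e w d := by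
  rw [← hf]
  exact operand_mem_unbSpan he (ncGateValues P.gates) (gates_mem_unbSpan he P.gates hP hunb)
    P.output hed le_rfl

/-- **SIZE FORM**: the bodies are components of `≤ P.size` values. [cite: LimayeMalodSrinivasan2016, Cor. 5.7] -/
theorem unbalanced_structure_size (P : ArithCircuit R σ) (hP : P.IsFanInTwo) {d e w : ℕ}
    (hunb : ∀ (l₁ : List (Gate R σ)) (o o' : Operand R σ) (l₂ : List (Gate R σ)),
      P.gates = l₁ ++ Gate.prod [o, o'] :: l₂ → ∀ b b' : ℕ, w + 2 ≤ b → w + 2 ≤ b' → b + b' ≤ d →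
        degPart d b (o.ncEval (ncGateValues l₁)) * degPart d b' (o'.ncEval (ncGateValues l₁)) = 0)
    (he : 2 ≤ e) (hed : e ≤ d) (hf : degPart d d P.ncEval = P.ncEval) :
    ∃ vals : List (FreeAlgebra R σ), vals.length = P.size ∧
      P.ncEval ∈ unbSpan (bodies vals d) d e w d :=
  ⟨ncGateValues P.gates, by
    show (ncGateValues P.gates).length = P.gates.length
    simpa using (ncGateValues_append_getD P.gates []).1, unbalanced_structure P hP hunb he hed hf⟩

/-! ## §3 The ends of the dial -/

/-- MONOTONICITY of the dial: widening the window (`w ≤ w'`) keeps the hypothesis.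
[cite: LimayeMalodSrinivasan2016, Def. 5.6] -/
theorem unbalanced_mono (gs : List (Gate R σ)) {d w w' : ℕ} (hww : w ≤ w')
    (hunb : ∀ (l₁ : List (Gate R σ)) (o o' : Operand R σ) (l₂ : List (Gate R σ)),
      gs = l₁ ++ Gate.prod [o, o'] :: l₂ → ∀ b b' : ℕ, w + 2 ≤ b → w + 2 ≤ b' → b + b' ≤ d →
        degPart d b (o.ncEval (ncGateValues l₁)) * degPart d b' (o'.ncEval (ncGateValues l₁)) = 0) :
    ∀ (l₁ : List (Gate R σ)) (o o' : Operand R σ) (l₂ : List (Gate R σ)),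
      gs = l₁ ++ Gate.prod [o, o'] :: l₂ → ∀ b b' : ℕ, w' + 2 ≤ b → w' + 2 ≤ b' → b + b' ≤ d →
        degPart d b (o.ncEval (ncGateValues l₁)) * degPart d b' (o'.ncEval (ncGateValues l₁)) = 0 :=
  fun l₁ o o' l₂ h b b' hb hb' hbb => hunb l₁ o o' l₂ h b b' (by omega) (by omega) hbb

/-- THE VACUOUS END of the dial: once `2 (w + 2) > d` there is no pair of degrees `b, b' ≥ w + 2`
with `b + b' ≤ d`, so EVERY program is `(w+2)`-unbalanced up to degree `d` — the dial ends at the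
class of all fan-in-two circuits. [cite: LimayeMalodSrinivasan2016, Def. 5.6] -/
theorem unbalanced_of_lt (gs : List (Gate R σ)) {d w : ℕ} (hdw : d < 2 * (w + 2)) :
    ∀ (l₁ : List (Gate R σ)) (o o' : Operand R σ) (l₂ : List (Gate R σ)),
      gs = l₁ ++ Gate.prod [o, o'] :: l₂ → ∀ b b' : ℕ, w + 2 ≤ b → w + 2 ≤ b' → b + b' ≤ d →
        degPart d b (o.ncEval (ncGateValues l₁)) * degPart d b' (o'.ncEval (ncGateValues l₁)) = 0 :=
  fun _ _ _ _ _ _ _ hb hb' hbb => absurd hbb (by omega)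

/-- **Def. 5.6 read semantically implies the hypothesis**: if at every product gate one operand's
VALUE has degree `≤ w + 1` — all its components of degrees `w + 2 ≤ b ≤ d + 1` vanish (`b = d + 1`
names the tail, the words longer than `d`) — then the program is `(w+2)`-unbalanced up to degree `d`.
(The syntactic class of Def. 5.6, `δ = w + 1`, is contained in this semantic one.)
[cite: LimayeMalodSrinivasan2016, Def. 5.6] -/
theorem unbalanced_of_degree (gs : List (Gate R σ)) {d w : ℕ}
    (hdeg : ∀ (l₁ : List (Gate R σ)) (o o' : Operand R σ) (l₂ : List (Gate R σ)),
      gs = l₁ ++ Gate.prod [o, o'] :: l₂ →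
        (∀ b : ℕ, w + 2 ≤ b → b ≤ d + 1 → degPart d b (o.ncEval (ncGateValues l₁)) = 0) ∨
        (∀ b : ℕ, w + 2 ≤ b → b ≤ d + 1 → degPart d b (o'.ncEval (ncGateValues l₁)) = 0)) :
    ∀ (l₁ : List (Gate R σ)) (o o' : Operand R σ) (l₂ : List (Gate R σ)),
      gs = l₁ ++ Gate.prod [o, o'] :: l₂ → ∀ b b' : ℕ, w + 2 ≤ b → w + 2 ≤ b' → b + b' ≤ d →
        degPart d b (o.ncEval (ncGateValues l₁)) * degPart d b' (o'.ncEval (ncGateValues l₁)) = 0 := by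
  intro l₁ o o' l₂ h b b' hb hb' hbb
  rcases hdeg l₁ o o' l₂ h with h0 | h0
  · rw [h0 b hb (by omega), zero_mul]
  · rw [h0 b' hb' (by omega), mul_zero]

/-- Components of a WORD at every index `e` (`e ≤ d`: degree `e`; `e ≥ d + 1`: the tail): the word
or `0`, by comparing `min |u| (d+1)` with `min e (d+1)`. [cite: HrubesWigdersonYehudayoff2010, §A] -/
theorem degPart_word' (d e : ℕ) (u : List σ) :
    degPart (R := R) d e ((u.map (FreeAlgebra.ι R)).prod) =
      if min u.length (d + 1) = min e (d + 1) then (u.map (FreeAlgebra.ι R)).prod else 0 := by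
  simp only [degPart, dfaProj_word, wordDfa_cnt, Nat.zero_add]

/-- Letters have no component at any index `2 ≤ a ≤ d + 1` (the tail included). [cite: HrubesWigdersonYehudayoff2010, §A] -/
theorem degPart_ι_eq_zero' {d a : ℕ} (ha : 2 ≤ a) (had : a ≤ d + 1) (x : σ) :
    degPart d a (FreeAlgebra.ι R x) = 0 := by
  have h := degPart_word' (R := R) d a [x]
  simp only [List.map_cons, List.map_nil, List.prod_cons, List.prod_nil, mul_one,
    List.length_cons, List.length_nil] at h
  rw [h, if_neg (by omega)]

/-- Scalars have no component at any index `a ≥ 1` (the tail included). [cite: HrubesWigdersonYehudayoff2010, §A] -/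
theorem degPart_algebraMap_eq_zero' {d a : ℕ} (ha : 1 ≤ a) (c : R) :
    degPart d a (algebraMap R (FreeAlgebra R σ) c) = 0 := by
  have h := degPart_word' (R := R) d a ([] : List σ)
  simp only [List.map_nil, List.prod_nil, List.length_nil] at h
  rw [Algebra.algebraMap_eq_smul_one, map_smul, h, if_neg (by omega), smul_zero]

/-- An INPUT operand (a letter or a scalar) has no component at any index `2 ≤ c ≤ d + 1`: its
value has degree `≤ 1`. [cite: LimayeMalodSrinivasan2016, §5 (skew ⊂ unbalanced)] -/
theorem degPart_input_eq_zero (vals : List (FreeAlgebra R σ)) {o : Operand R σ}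
    (ho : o.isGateRef = false) {d c : ℕ} (hc : 2 ≤ c) (hcd : c ≤ d + 1) :
    degPart d c (o.ncEval vals) = 0 := by
  cases o with
  | var x => exact degPart_ι_eq_zero' hc hcd x
  | const a => exact degPart_algebraMap_eq_zero' (by omega) a
  | gate i => exact absurd ho (by simp [Operand.isGateRef])

/-- **The skew end, semantically**: in a SKEW program every product gate has an input operand, whose
value has degree `≤ 1 ≤ w + 1` — Def. 5.6 (semantic) for EVERY `w`. [cite: LimayeMalodSrinivasan2016, §5 (skew ⊂ unbalanced)] -/
theorem skew_degree (gs : List (Gate R σ)) (hsk : ∀ g ∈ gs, g.IsSkew) {d w : ℕ} :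
    ∀ (l₁ : List (Gate R σ)) (o o' : Operand R σ) (l₂ : List (Gate R σ)),
      gs = l₁ ++ Gate.prod [o, o'] :: l₂ →
        (∀ b : ℕ, w + 2 ≤ b → b ≤ d + 1 → degPart d b (o.ncEval (ncGateValues l₁)) = 0) ∨
        (∀ b : ℕ, w + 2 ≤ b → b ≤ d + 1 → degPart d b (o'.ncEval (ncGateValues l₁)) = 0) := by
  intro l₁ o o' l₂ hgs
  have hmem : Gate.prod [o, o'] ∈ gs := by rw [hgs]; simp
  have hcnt : [o, o'].countP Operand.isGateRef ≤ 1 := hsk _ hmem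
  cases ho : o.isGateRef with
  | false =>
    exact Or.inl fun b hb hbd => degPart_input_eq_zero (ncGateValues l₁) ho (by omega) hbd
  | true =>
    cases ho' : o'.isGateRef with
    | false =>
      exact Or.inr fun b hb hbd => degPart_input_eq_zero (ncGateValues l₁) ho' (by omega) hbd
    | true =>
      exfalso
      rw [List.countP_cons, List.countP_cons, List.countP_nil, ho, ho'] at hcnt
      simp at hcnt

/-- **The skew end of the dial** (`w = 0`): a SKEW program is `2`-unbalanced up to every degree `d`.
[cite: LimayeMalodSrinivasan2016, §5 (skew ⊂ unbalanced)] -/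
theorem skew_unbalanced (gs : List (Gate R σ)) (hsk : ∀ g ∈ gs, g.IsSkew) {d : ℕ} :
    ∀ (l₁ : List (Gate R σ)) (o o' : Operand R σ) (l₂ : List (Gate R σ)),
      gs = l₁ ++ Gate.prod [o, o'] :: l₂ → ∀ b b' : ℕ, 2 ≤ b → 2 ≤ b' → b + b' ≤ d →
        degPart d b (o.ncEval (ncGateValues l₁)) * degPart d b' (o'.ncEval (ncGateValues l₁)) = 0 :=
  unbalanced_of_degree gs (w := 0) (skew_degree gs hsk)

/-- The skew structure theorem of `NcSkewStructure`, recovered at `w = 0`. [cite: LimayeMalodSrinivasan2016, Lemma 5.2] -/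
theorem skew_structure_window (P : ArithCircuit R σ) (hP : P.IsFanInTwo) (hS : P.IsSkew) {d e : ℕ}
    (he : 2 ≤ e) (hed : e ≤ d) (hf : degPart d d P.ncEval = P.ncEval) :
    P.ncEval ∈ unbSpan (bodies (ncGateValues P.gates) d) d e 0 d :=
  unbalanced_structure P hP (skew_unbalanced P.gates hS) he hed hf

end Summit.ValiantsHypothesis.ValiantsHypothesis.Theorems.NcUnbalancedStructure

end
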